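import Literature.Analysis.FluidPDE.ClassicalSolution
import Literature.Analysis.FluidPDE.SchefferTestFunction
import Literature.Analysis.UnboundedOperators.HeatKernelHeatEquation
import Mathlib.Analysis.Calculus.TangentCone.Real
import HarnessLib

/-!
# Flow-adapted backward kernels of the advection–diffusion operator; adapted enstrophy and frequency

Analysis/FluidPDE definition file (everything proved; no named facts). It vendors the notion
requested by route `AdaptedFrequency` of `NavierStokesRegularity` (items
`AdaptedFrequencyConverges`, `FrequencyRigidity`, `AdaptedKernelExists`, `TangentFlowTransfer`,
which today inline the five clauses below verbatim), together with its three companions.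

Let `E` be a finite-dimensional real inner product space with its Lebesgue measure (the route
takes `E = ℝ³`), `ν` a diffusivity, `u : ℝ → E → E` a (velocity) field, `S ⊆ ℝ` a set of times
(typically `Ico t₀ T`, or `Iio 0` with `T = 0` for ancient flows), `T` a terminal time and
`x₀ ∈ E` a terminal point.

## Main definitions

* `Literature.Analysis.FluidPDE.IsAdaptedBackwardKernel ν u S T x₀ G`: `G : ℝ → E → ℝ` is the
  **flow-adapted backward kernel** of `∂ₜ + u·∇ − νΔ` on the time set `S` ending at the Dirac mass
  `δ_{x₀}` at time `T`: (1) `G` is jointly `C²` on `S × E`; (2) `G > 0` there; (3) the **adjoint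
  equation** `∂ₜG + u·∇G + νΔG = 0` on `S × E` (with the tree's one-sided `timeDerivWithin S`,
  Mathlib's `fderiv` and Laplacian `Δ`); (4) unit mass `∫ G(t, x) dx = 1` for `t ∈ S`;
  (5) concentration `∫ φ G(t) → φ(x₀)` as `t ↑ T` for every bounded continuous `φ`.
  For Friedman's `L = νΔ − u·∇ − ∂ₜ` the adjoint operator is `L*v = νΔv + div (u v) + ∂ₜv`
  (Friedman 1964, Ch. 1, §8, (8.1)–(8.3)), `= ∂ₜv + u·∇v + νΔv` when `div u = 0`, so (3) and (5)
  say that `G(t, x) = Γ*(x, t; x₀, T)` is a fundamental solution of the adjoint (backward)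
  equation with pole `(x₀, T)` (ibid., Definition following (8.7); Thm 15:
  `Γ(x, t; ξ, τ) = Γ*(ξ, τ; x, t)`) — in probabilistic terms the density at time `t` of the
  backward stochastic Lagrangian particle `dX = u dt + √(2ν) dW` that ends at `x₀` at time `T`
  (Constantin–Iyer 2008, §2). The point of the notion (the route's
  rationale): for every nice scalar `q`, `d/dt ∫ q(t) G(t) = ∫ (∂ₜq + u·∇q − νΔq) G(t)` — transport
  drops out of the first variation *exactly*.
* `Literature.Analysis.FluidPDE.IsGaussianComparable G S T x₀`: Aronson-type two-sided bounds
  `c₁ (T−t)^{-n/2} e^{−‖x−x₀‖²/(c₂(T−t))} ≤ G(t, x) ≤ C₁ (T−t)^{-n/2} e^{−‖x−x₀‖²/(C₂(T−t))}` on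
  `S × E`, `n = dim E` (Aronson 1967, Thm 1: the fundamental solution of a uniformly parabolic
  equation with bounded measurable coefficients is comparable above and below with Gaussians).
* `Literature.Analysis.FluidPDE.adaptedEnstrophy u G t = ∫ ‖curl u(t)‖² G(t)` and
  `Literature.Analysis.FluidPDE.adaptedFrequency u G T t = (T − t) H′(t) / H(t)`,
  `H = adaptedEnstrophy u G` (on `ℝ³`, where the tree's `curl` lives): the enstrophy weighted by
  the kernel and its Almgren–Poon-type frequency, i.e. the logarithmic derivative `d log H / ds`
  in similarity time `s = −log (T − t)` (cf. Poon 1996 for the parabolic frequency function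
  against the backward heat kernel). These are the quantities `H`, `Λ` of the route.
* `Literature.Analysis.FluidPDE.backwardHeatKernel ν T x₀ t x = G_{ν(T−t)}(x − x₀)`, the backward
  heat kernel with pole at `(T, x₀)` (`G_a` the Gauss–Weierstrass kernel
  `Literature.Analysis.UnboundedOperators.heatKernel`).

## Main statements (all proved)

* `isAdaptedBackwardKernel_iff`: unfolding to the five-clause conjunction, verbatim as inlined in
  the route items (so they can be restated 1:1).
* `IsAdaptedBackwardKernel.mono`: restriction to a smaller time set of unique differentiability.
* `isAdaptedBackwardKernel_backwardHeatKernel`: **for `u ≡ 0` the backward heat kernel is a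
  flow-adapted backward kernel** on `Iio T` (non-vacuity; Evans 2010, §2.3.1, Thm 1: the heat
  kernel is smooth, positive, has unit mass, solves the heat equation, and `G_σ ⋆ φ → φ(x₀)`),
  with the corollary `isAdaptedBackwardKernel_backwardHeatKernel_Ico` on `Ico t₀ T`;
  `isGaussianComparable_backwardHeatKernel`: it is Gaussian-comparable (with equal constants).
* `adaptedEnstrophy_nonneg`.

## Design notes

* `S` and `T` are independent parameters: `T` and `x₀` enter only through clause (5); nothing
  forces `S ⊆ Iio T` (the two uses are `S = Ico t₀ T` and `S = Iio 0`, `T = 0`).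
* Clause (3) uses the ambient drift `u t x` at every `x`; no divergence-free or regularity
  assumption on `u` is built in (they come with the solution class in the route items).
* Junk values: `adaptedFrequency` is `0` where `H t = 0` (division by zero) and uses Mathlib's
  `deriv` (junk `0` where `H` is not differentiable), exactly as the inline `Λ` of the route.
* Mathlib / tree search: no `AdaptedBackwardKernel`, `adjoint heat kernel`, `GaussianComparable`,
  `adaptedEnstrophy`, `frequency function` notions in Mathlib or `Literature` (`lean search`);
  the heat-kernel calculus used for the model case is the tree's
  (`UnboundedOperators.HeatKernelHeatEquation`, `FluidPDE.SchefferTestFunction`).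

## References

* A. Friedman, *Partial Differential Equations of Parabolic Type*, Prentice-Hall (1964), Ch. 1,
  §8 "The adjoint equation" (p. 26): (8.1)–(8.3), Definition of `Γ*`, (8.13), Thm 15. [Friedman1964]
* D. G. Aronson, *Bounds for the fundamental solution of a parabolic equation*, Bull. Amer. Math.
  Soc. 73 (1967) 890–896, Theorem 1. [Aronson1967]
* P. Constantin, G. Iyer, *A stochastic Lagrangian representation of the three-dimensional
  incompressible Navier–Stokes equations*, Comm. Pure Appl. Math. 61 (2008) 330–345
  (arXiv:math/0511067), §2. [ConstantinIyer2007]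
* C.-C. Poon, *Unique continuation for parabolic equations*, Comm. PDE 21 (1996) 521–539. [Poon1996]
* L. C. Evans, *Partial Differential Equations*, 2nd ed., AMS (2010), §2.3.1, Theorem 1. [Evans2010]
-/

noncomputable section

open MeasureTheory Set Function Filter Topology
open scoped Laplacian

namespace Literature.Analysis.FluidPDE

variable {E : Type*} [NormedAddCommGroup E] [InnerProductSpace ℝ E]

/-! ### Flow-adapted backward kernels -/

section Kernel

variable [FiniteDimensional ℝ E] [MeasurableSpace E] [BorelSpace E]

/-- **Flow-adapted backward kernel.** `IsAdaptedBackwardKernel ν u S T x₀ G`: on the time set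
`S`, `G : ℝ → E → ℝ` is (1) jointly `C²` on `S × E`, (2) positive, (3) a solution of the adjoint
equation `∂ₜG + u·∇G + νΔG = 0` of the advection–diffusion operator `∂ₜ + u·∇ − νΔ` (formal
adjoint when `div u = 0`; one-sided time derivative within `S`), (4) of unit mass
`∫ G(t, ·) = 1`, and (5) concentrating at `x₀` as `t ↑ T`: `∫ φ G(t, ·) → φ(x₀)` for every bounded
continuous `φ`. I.e. `G(t, x) = Γ*(x, t; x₀, T)` is a fundamental solution, with pole `(x₀, T)`,
of the adjoint equation `L*v = νΔv + div (u v) + ∂ₜv = 0` of `L = νΔ − u·∇ − ∂ₜ` (Friedman 1964,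
Ch. 1, §8: (8.1)–(8.3), the Definition following (8.7), Thm 15 `Γ(x, t; ξ, τ) = Γ*(ξ, τ; x, t)`)
— the density of the backward stochastic Lagrangian particle of the drift `u` ending at `x₀` at
time `T` (Constantin–Iyer 2008, §2); for `u ≡ 0` it is the backward heat kernel
(`isAdaptedBackwardKernel_backwardHeatKernel`). [cite: Friedman1964, Ch. 1 §8 (8.3) and Definition after (8.7)] -/
structure IsAdaptedBackwardKernel (ν : ℝ) (u : ℝ → E → E) (S : Set ℝ) (T : ℝ) (x₀ : E)
    (G : ℝ → E → ℝ) : Prop where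
  /-- (1) `G` is jointly `C²` on `S × E`. -/
  contDiffOn : ContDiffOn ℝ 2 (uncurry G) (S ×ˢ univ)
  /-- (2) `G > 0` on `S × E`. -/
  pos : ∀ t ∈ S, ∀ x, 0 < G t x
  /-- (3) the adjoint equation `∂ₜG + u·∇G + νΔG = 0` on `S × E`. -/
  adjoint_eq : ∀ t ∈ S, ∀ x,
    timeDerivWithin S G t x + fderiv ℝ (G t) x (u t x) + ν * (Δ (G t)) x = 0
  /-- (4) unit mass. -/
  integral_eq_one : ∀ t ∈ S, ∫ x, G t x = 1
  /-- (5) `G(t, x) dx ⇀ δ_{x₀}` as `t ↑ T`, tested against bounded continuous functions. -/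
  tendsto_integral_mul : ∀ φ : E → ℝ, Continuous φ → (∃ M : ℝ, ∀ x, |φ x| ≤ M) →
    Tendsto (fun t => ∫ x, φ x * G t x) (𝓝[<] T) (𝓝 (φ x₀))

variable {ν : ℝ} {u : ℝ → E → E} {S : Set ℝ} {T : ℝ} {x₀ : E} {G : ℝ → E → ℝ}

/-- Unfolding `IsAdaptedBackwardKernel` to the five-clause conjunction, verbatim as the clauses
are inlined in the route items of `AdaptedFrequency`. [folklore] -/
theorem isAdaptedBackwardKernel_iff :
    IsAdaptedBackwardKernel ν u S T x₀ G ↔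
      ContDiffOn ℝ 2 (uncurry G) (S ×ˢ univ) ∧ (∀ t ∈ S, ∀ x, 0 < G t x) ∧
      (∀ t ∈ S, ∀ x,
        timeDerivWithin S G t x + fderiv ℝ (G t) x (u t x) + ν * (Δ (G t)) x = 0) ∧
      (∀ t ∈ S, ∫ x, G t x = 1) ∧
      (∀ φ : E → ℝ, Continuous φ → (∃ M : ℝ, ∀ x, |φ x| ≤ M) →
        Tendsto (fun t => ∫ x, φ x * G t x) (𝓝[<] T) (𝓝 (φ x₀))) :=
  ⟨fun ⟨h₁, h₂, h₃, h₄, h₅⟩ => ⟨h₁, h₂, h₃, h₄, h₅⟩, fun ⟨h₁, h₂, h₃, h₄, h₅⟩ => ⟨h₁, h₂, h₃, h₄, h₅⟩⟩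

/-- The time slices `G t`, `t ∈ S`, of an adapted kernel are `C²`. [folklore] -/
theorem IsAdaptedBackwardKernel.contDiff_slice (h : IsAdaptedBackwardKernel ν u S T x₀ G) {t : ℝ}
    (ht : t ∈ S) : ContDiff ℝ 2 (G t) := by
  have hc : ContDiff ℝ 2 (fun x : E => ((t, x) : ℝ × E)) := contDiff_const.prodMk contDiff_id
  have := h.contDiffOn.comp_contDiff hc (fun x => mk_mem_prod ht (mem_univ x))
  simpa [Function.comp_def] using this

/-- Each time line `s ↦ G s x` of an adapted kernel is differentiable within `S`. [folklore] -/
theorem IsAdaptedBackwardKernel.differentiableWithinAt_time (h : IsAdaptedBackwardKernel ν u S T x₀ G)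
    {t : ℝ} (ht : t ∈ S) (x : E) : DifferentiableWithinAt ℝ (fun s => G s x) S t := by
  have h1 : DifferentiableWithinAt ℝ (uncurry G) (S ×ˢ univ) (t, x) :=
    (h.contDiffOn.differentiableOn (by norm_num)) (t, x) ⟨ht, mem_univ x⟩
  have h2 : DifferentiableWithinAt ℝ (fun s : ℝ => ((s, x) : ℝ × E)) S t :=
    differentiableWithinAt_id.prodMk (differentiableWithinAt_const _)
  have h3 : MapsTo (fun s : ℝ => ((s, x) : ℝ × E)) S (S ×ˢ univ) := fun s hs => ⟨hs, mem_univ x⟩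
  exact h1.comp t h2 h3

/-- The slices of an adapted kernel are integrable (their integral is `1 ≠ 0`). [folklore] -/
theorem IsAdaptedBackwardKernel.integrable (h : IsAdaptedBackwardKernel ν u S T x₀ G) {t : ℝ}
    (ht : t ∈ S) : Integrable (G t) := by
  by_contra hG
  have h1 := h.integral_eq_one t ht
  rw [integral_undef hG] at h1
  exact zero_ne_one h1

/-- **Restriction of the time set.** An adapted kernel on `S` is an adapted kernel on every
`S' ⊆ S` of unique differentiability (e.g. any interval), with the same pole: the one-sided time
derivatives within `S'` and `S` agree at points of `S'` (Mathlib `derivWithin_subset`). [folklore] -/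
theorem IsAdaptedBackwardKernel.mono (h : IsAdaptedBackwardKernel ν u S T x₀ G) {S' : Set ℝ}
    (hS' : S' ⊆ S) (hU : UniqueDiffOn ℝ S') : IsAdaptedBackwardKernel ν u S' T x₀ G where
  contDiffOn := h.contDiffOn.mono (prod_mono hS' Subset.rfl)
  pos t ht := h.pos t (hS' ht)
  adjoint_eq t ht x := by
    rw [timeDerivWithin_apply,
      derivWithin_subset hS' (hU t ht) (h.differentiableWithinAt_time (hS' ht) x),
      ← timeDerivWithin_apply]
    exact h.adjoint_eq t (hS' ht) x
  integral_eq_one t ht := h.integral_eq_one t (hS' ht)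
  tendsto_integral_mul := h.tendsto_integral_mul

end Kernel

/-! ### Two-sided Gaussian comparability -/

section Gaussian

/-- **Two-sided Gaussian comparability** of `G : ℝ → E → ℝ` on the time set `S` about the pole
`(T, x₀)`: there are positive constants `c₁, c₂, C₁, C₂` with
`c₁ (T−t)^{-n/2} exp(−‖x−x₀‖²/(c₂ (T−t))) ≤ G t x ≤ C₁ (T−t)^{-n/2} exp(−‖x−x₀‖²/(C₂ (T−t)))`
for `t ∈ S` and all `x`, `n = dim E` — the shape of Aronson's bounds
`K⁻¹ γ₁(x−ξ, t−τ) ≤ g(x, t; ξ, τ) ≤ K γ₂(x−ξ, t−τ)`, `γᵢ` the fundamental solution of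
`αᵢ Δu = uₜ` (Aronson 1967, Thm 1), written backward from the pole. [cite: Aronson1967, Thm 1] -/
def IsGaussianComparable (G : ℝ → E → ℝ) (S : Set ℝ) (T : ℝ) (x₀ : E) : Prop :=
  ∃ c₁ c₂ C₁ C₂ : ℝ, 0 < c₁ ∧ 0 < c₂ ∧ 0 < C₁ ∧ 0 < C₂ ∧ ∀ t ∈ S, ∀ x,
    c₁ * (T - t) ^ (-(Module.finrank ℝ E : ℝ) / 2) * Real.exp (-(‖x - x₀‖ ^ 2) / (c₂ * (T - t))) ≤
        G t x ∧
      G t x ≤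
        C₁ * (T - t) ^ (-(Module.finrank ℝ E : ℝ) / 2) * Real.exp (-(‖x - x₀‖ ^ 2) / (C₂ * (T - t)))

/-- On `ℝ³` the exponent is `−3/2`: unfolding `IsGaussianComparable` verbatim to the clause inlined
in the route items of `AdaptedFrequency`. [folklore] -/
theorem isGaussianComparable_iff_fin_three {G : ℝ → EuclideanSpace ℝ (Fin 3) → ℝ} {S : Set ℝ}
    {T : ℝ} {x₀ : EuclideanSpace ℝ (Fin 3)} :
    IsGaussianComparable G S T x₀ ↔
      ∃ c₁ c₂ C₁ C₂ : ℝ, 0 < c₁ ∧ 0 < c₂ ∧ 0 < C₁ ∧ 0 < C₂ ∧ ∀ t ∈ S, ∀ x,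
        c₁ * (T - t) ^ (-(3 : ℝ) / 2) * Real.exp (-(‖x - x₀‖ ^ 2) / (c₂ * (T - t))) ≤ G t x ∧
          G t x ≤ C₁ * (T - t) ^ (-(3 : ℝ) / 2) * Real.exp (-(‖x - x₀‖ ^ 2) / (C₂ * (T - t))) := by
  simp only [IsGaussianComparable, finrank_euclideanSpace_fin, Nat.cast_ofNat]

end Gaussian

/-! ### Adapted enstrophy and adapted frequency (`ℝ³`) -/

/-- **Adapted enstrophy** `H(t) = ∫ ‖curl u(t, x)‖² G(t, x) dx`: the enstrophy of `u(t)` weighted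
by the kernel `G(t)` (Bochner integral; junk `0` if not integrable). The quantity `H` of route
`AdaptedFrequency`. [folklore] -/
def adaptedEnstrophy (u : ℝ → EuclideanSpace ℝ (Fin 3) → EuclideanSpace ℝ (Fin 3))
    (G : ℝ → EuclideanSpace ℝ (Fin 3) → ℝ) (t : ℝ) : ℝ :=
  ∫ x, ‖curl (u t) x‖ ^ 2 * G t x

/-- **Adapted frequency** `Λ(t) = (T − t) H′(t) / H(t)`, `H = adaptedEnstrophy u G`: the
logarithmic derivative of the adapted enstrophy in similarity time `s = −log (T − t)`
(`dH/ds = (T − t) H′(t)`), an Almgren–Poon-type frequency (cf. Poon 1996). Mathlib `deriv`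
(junk `0` where `H` is not differentiable) and junk `0` where `H t = 0`. The quantity `Λ` of
route `AdaptedFrequency` (`Λ ≡ 2` on backward self-similar flows). [folklore] -/
def adaptedFrequency (u : ℝ → EuclideanSpace ℝ (Fin 3) → EuclideanSpace ℝ (Fin 3))
    (G : ℝ → EuclideanSpace ℝ (Fin 3) → ℝ) (T t : ℝ) : ℝ :=
  (T - t) * deriv (adaptedEnstrophy u G) t / adaptedEnstrophy u G t

/-- Unfolding `adaptedEnstrophy`. [folklore] -/
theorem adaptedEnstrophy_apply (u : ℝ → EuclideanSpace ℝ (Fin 3) → EuclideanSpace ℝ (Fin 3))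
    (G : ℝ → EuclideanSpace ℝ (Fin 3) → ℝ) (t : ℝ) :
    adaptedEnstrophy u G t = ∫ x, ‖curl (u t) x‖ ^ 2 * G t x :=
  rfl

/-- Unfolding `adaptedFrequency`. [folklore] -/
theorem adaptedFrequency_apply (u : ℝ → EuclideanSpace ℝ (Fin 3) → EuclideanSpace ℝ (Fin 3))
    (G : ℝ → EuclideanSpace ℝ (Fin 3) → ℝ) (T t : ℝ) :
    adaptedFrequency u G T t =
      (T - t) * deriv (adaptedEnstrophy u G) t / adaptedEnstrophy u G t :=
  rfl

/-- The adapted enstrophy is nonnegative whenever the kernel slice is. [folklore] -/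
theorem adaptedEnstrophy_nonneg {u : ℝ → EuclideanSpace ℝ (Fin 3) → EuclideanSpace ℝ (Fin 3)}
    {G : ℝ → EuclideanSpace ℝ (Fin 3) → ℝ} {t : ℝ} (hG : ∀ x, 0 ≤ G t x) :
    0 ≤ adaptedEnstrophy u G t :=
  integral_nonneg fun x => mul_nonneg (sq_nonneg _) (hG x)

/-! ### The model case `u ≡ 0`: the backward heat kernel -/

section Heat

/-- The **backward heat kernel with pole `(T, x₀)`** and diffusivity `ν`:
`backwardHeatKernel ν T x₀ t x = G_{ν(T−t)}(x − x₀) = (4πν(T−t))^{-n/2} e^{−‖x−x₀‖²/(4ν(T−t))}`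
(`t < T`; junk for `t ≥ T`), the fundamental solution of the backward heat equation
`∂ₜΓ + νΔΓ = 0` (Evans 2010, §2.3.1). [folklore] -/
def backwardHeatKernel (ν T : ℝ) (x₀ : E) (t : ℝ) (x : E) : ℝ :=
  UnboundedOperators.heatKernel (ν * (T - t)) (x - x₀)

variable {ν : ℝ}

/-- The backward heat kernel is jointly smooth on `(−∞, T) × E` (from the tree's
`UnboundedOperators.contDiffOn_uncurry_heatKernel`). [folklore] -/
theorem contDiffOn_uncurry_backwardHeatKernel (hν : 0 < ν) (T : ℝ) (x₀ : E) {m : WithTop ℕ∞} :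
    ContDiffOn ℝ m (uncurry (backwardHeatKernel ν T x₀)) (Iio T ×ˢ univ) := by
  have h1 : ContDiff ℝ m (fun p : ℝ × E => (ν * (T - p.1), p.2 - x₀)) := by fun_prop
  have h2 : MapsTo (fun p : ℝ × E => (ν * (T - p.1), p.2 - x₀)) (Iio T ×ˢ univ)
      (Ioi (0 : ℝ) ×ˢ univ) := by
    rintro ⟨t, x⟩ ⟨ht, -⟩
    exact ⟨mul_pos hν (sub_pos.2 ht), mem_univ _⟩
  exact (UnboundedOperators.contDiffOn_uncurry_heatKernel (E := E)).comp h1.contDiffOn h2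

/-- Time derivative of the backward heat kernel: with `σ = ν(T − t) > 0` and `z = x − x₀`,
`∂ₜ Γ(t, x) = −ν (‖z‖²/(4σ²) − n/(2σ)) G_σ(z)` (chain rule with the tree's
`UnboundedOperators.hasDerivAt_heatKernel_time`). [folklore] -/
theorem hasDerivAt_backwardHeatKernel (hν : 0 < ν) {T : ℝ} (x₀ : E) {t : ℝ} (ht : t < T) (x : E) :
    HasDerivAt (fun s => backwardHeatKernel ν T x₀ s x)
      (-(ν * ((‖x - x₀‖ ^ 2 / (4 * (ν * (T - t)) ^ 2) -
          (Module.finrank ℝ E : ℝ) / (2 * (ν * (T - t)))) *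
        UnboundedOperators.heatKernel (ν * (T - t)) (x - x₀)))) t := by
  have hσ : 0 < ν * (T - t) := mul_pos hν (sub_pos.2 ht)
  have hin : HasDerivAt (fun s : ℝ => ν * (T - s)) (ν * (0 - 1)) t :=
    ((hasDerivAt_const t T).sub (hasDerivAt_id t)).const_mul ν
  have h2 := (UnboundedOperators.hasDerivAt_heatKernel_time hσ (x - x₀)).comp t hin
  have h3 : HasDerivAt (fun s => backwardHeatKernel ν T x₀ s x)
      ((‖x - x₀‖ ^ 2 / (4 * (ν * (T - t)) ^ 2) - (Module.finrank ℝ E : ℝ) / (2 * (ν * (T - t)))) *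
        UnboundedOperators.heatKernel (ν * (T - t)) (x - x₀) * (ν * (0 - 1))) t := h2
  exact h3.congr_deriv (by ring)

section FinDim

variable [FiniteDimensional ℝ E]

/-- Translation invariance of the Laplacian, `Δ(f(· − a))(x) = (Δf)(x − a)` (Mathlib:
`iteratedFDeriv_comp_sub`). [folklore] -/
private theorem laplacian_comp_sub_const {F : Type*} [NormedAddCommGroup F] [NormedSpace ℝ F]
    (f : E → F) (a x : E) : (Δ (fun y => f (y - a))) x = (Δ f) (x - a) := by
  rw [InnerProductSpace.laplacian_eq_iteratedFDeriv_stdOrthonormalBasis,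
    InnerProductSpace.laplacian_eq_iteratedFDeriv_stdOrthonormalBasis]
  simp only [iteratedFDeriv_comp_sub]

/-- Laplacian of the backward heat kernel: with `σ = ν(T − t)`, `z = x − x₀`,
`Δ Γ(t, ·)(x) = (‖z‖²/(4σ²) − n/(2σ)) G_σ(z)` (the tree's `Scheffer.laplacian_heatKernel`).
[folklore] -/
theorem laplacian_backwardHeatKernel (ν T : ℝ) (x₀ : E) (t : ℝ) (x : E) :
    (Δ (backwardHeatKernel ν T x₀ t)) x =
      (‖x - x₀‖ ^ 2 / (4 * (ν * (T - t)) ^ 2) - (Module.finrank ℝ E : ℝ) / (2 * (ν * (T - t)))) *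
        UnboundedOperators.heatKernel (ν * (T - t)) (x - x₀) := by
  rw [show backwardHeatKernel ν T x₀ t =
      fun y => UnboundedOperators.heatKernel (ν * (T - t)) (y - x₀) from rfl,
    laplacian_comp_sub_const, Scheffer.laplacian_heatKernel]

/-- **The backward heat kernel solves the backward heat equation** `∂ₜΓ + νΔΓ = 0` on
`(−∞, T) × E` (Evans 2010, §2.3.1: `Φₜ = ΔΦ` away from the pole, run backward). [folklore] -/
theorem backwardHeatKernel_backward_heat_eq (hν : 0 < ν) {T : ℝ} (x₀ : E) {t : ℝ} (ht : t < T)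
    (x : E) :
    timeDerivWithin (Iio T) (backwardHeatKernel ν T x₀) t x +
        ν * (Δ (backwardHeatKernel ν T x₀ t)) x = 0 := by
  rw [timeDerivWithin_apply, derivWithin_of_mem_nhds (Iio_mem_nhds ht),
    (hasDerivAt_backwardHeatKernel hν x₀ ht x).deriv, laplacian_backwardHeatKernel]
  ring

section Measure

variable [MeasurableSpace E] [BorelSpace E]

/-- The backward heat kernel has unit mass at every `t < T` (translation invariance and the
tree's `integral_heatKernel_eq_one_holds`; Evans 2010, §2.3.1, Lemma). [folklore] -/
theorem integral_backwardHeatKernel (hν : 0 < ν) {T : ℝ} (x₀ : E) {t : ℝ} (ht : t < T) :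
    ∫ x, backwardHeatKernel ν T x₀ t x = 1 := by
  have hσ : 0 < ν * (T - t) := mul_pos hν (sub_pos.2 ht)
  simp only [backwardHeatKernel]
  rw [integral_sub_right_eq_self (fun x => UnboundedOperators.heatKernel (ν * (T - t)) x) x₀]
  exact UnboundedOperators.integral_heatKernel_eq_one_holds hσ

/-- The integral of a function `φ` against the backward heat kernel is the caloric extension
`e^{ν(T−t)Δ} φ (x₀)` (evenness of the Gauss–Weierstrass kernel). [folklore] -/
theorem integral_mul_backwardHeatKernel (ν T : ℝ) (x₀ : E) (t : ℝ) (φ : E → ℝ) :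
    ∫ x, φ x * backwardHeatKernel ν T x₀ t x =
      UnboundedOperators.heatExtension φ (ν * (T - t)) x₀ := by
  rw [UnboundedOperators.heatExtension_eq_integral_sub]
  refine integral_congr_ae (Eventually.of_forall fun y => ?_)
  simp only [smul_eq_mul, backwardHeatKernel]
  rw [← neg_sub y x₀, UnboundedOperators.heatKernel_neg, mul_comm]

/-- **Concentration at the pole**: for bounded continuous `φ`, `∫ φ Γ(t, ·) → φ(x₀)` as `t ↑ T`
(Evans 2010, §2.3.1, Thm 1 (iii), through the tree's
`UnboundedOperators.tendsto_heatExtension_nhdsWithin_prod`). [folklore] -/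
theorem tendsto_integral_mul_backwardHeatKernel (hν : 0 < ν) (T : ℝ) (x₀ : E) {φ : E → ℝ}
    (hφ : Continuous φ) {M : ℝ} (hM : ∀ x, |φ x| ≤ M) :
    Tendsto (fun t => ∫ x, φ x * backwardHeatKernel ν T x₀ t x) (𝓝[<] T) (𝓝 (φ x₀)) := by
  have hM' : ∀ z, ‖φ z‖ ≤ M := fun z => by rw [Real.norm_eq_abs]; exact hM z
  have h1 := UnboundedOperators.tendsto_heatExtension_nhdsWithin_prod (F := ℝ) hφ hM' x₀
  have h2 : Tendsto (fun t : ℝ => (ν * (T - t), x₀)) (𝓝[<] T)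
      (𝓝[Ioi (0 : ℝ) ×ˢ univ] ((0 : ℝ), x₀)) := by
    refine tendsto_nhdsWithin_iff.2 ⟨?_, ?_⟩
    · have hc : Continuous (fun t : ℝ => (ν * (T - t), x₀)) := by fun_prop
      have := hc.tendsto T
      simp only [sub_self, mul_zero] at this
      exact this.mono_left nhdsWithin_le_nhds
    · filter_upwards [self_mem_nhdsWithin] with t ht
      exact ⟨mul_pos hν (sub_pos.2 ht), mem_univ _⟩
  refine Tendsto.congr (fun t => ?_) (h1.comp h2)
  simp only [Function.comp_apply]
  exact (integral_mul_backwardHeatKernel ν T x₀ t φ).symm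

/-- **Non-vacuity / the model case.** For `u ≡ 0` and `ν > 0`, the backward heat kernel with
pole `(T, x₀)` is a flow-adapted backward kernel on `(−∞, T)` ending at `δ_{x₀}` at time `T`
(Evans 2010, §2.3.1, Thm 1). [folklore] -/
theorem isAdaptedBackwardKernel_backwardHeatKernel (hν : 0 < ν) (T : ℝ) (x₀ : E) :
    IsAdaptedBackwardKernel ν 0 (Iio T) T x₀ (backwardHeatKernel ν T x₀) where
  contDiffOn := contDiffOn_uncurry_backwardHeatKernel hν T x₀
  pos t ht x := UnboundedOperators.heatKernel_pos (mul_pos hν (sub_pos.2 ht)) _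
  adjoint_eq t ht x := by
    have h := backwardHeatKernel_backward_heat_eq hν x₀ (show t < T from ht) x
    simpa only [Pi.zero_apply, map_zero, add_zero] using h
  integral_eq_one t ht := integral_backwardHeatKernel hν x₀ ht
  tendsto_integral_mul φ hφ hM := by
    obtain ⟨M, hM⟩ := hM
    exact tendsto_integral_mul_backwardHeatKernel hν T x₀ hφ hM

/-- The model case on a window `[t₀, T)` (any `t₀`): the backward heat kernel is an adapted
kernel of `u ≡ 0` on `Ico t₀ T` (restriction `IsAdaptedBackwardKernel.mono`, `uniqueDiffOn_Ico`).
[folklore] -/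
theorem isAdaptedBackwardKernel_backwardHeatKernel_Ico (hν : 0 < ν) (t₀ T : ℝ) (x₀ : E) :
    IsAdaptedBackwardKernel ν 0 (Ico t₀ T) T x₀ (backwardHeatKernel ν T x₀) :=
  (isAdaptedBackwardKernel_backwardHeatKernel hν T x₀).mono Ico_subset_Iio_self (uniqueDiffOn_Ico t₀ T)

end Measure

end FinDim

/-- The backward heat kernel in product form: for `t < T`,
`Γ(t, x) = (4πν)^{-n/2} (T−t)^{-n/2} e^{−‖x−x₀‖²/(4ν(T−t))}`. [folklore] -/
theorem backwardHeatKernel_eq (hν : 0 ≤ ν) {T : ℝ} (x₀ : E) {t : ℝ} (ht : t < T) (x : E) :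
    backwardHeatKernel ν T x₀ t x =
      (4 * Real.pi * ν) ^ (-(Module.finrank ℝ E : ℝ) / 2) *
        (T - t) ^ (-(Module.finrank ℝ E : ℝ) / 2) *
        Real.exp (-(‖x - x₀‖ ^ 2) / (4 * ν * (T - t))) := by
  have hTt : 0 ≤ T - t := (sub_pos.2 ht).le
  simp only [backwardHeatKernel, UnboundedOperators.heatKernel]
  rw [show 4 * Real.pi * (ν * (T - t)) = (4 * Real.pi * ν) * (T - t) by ring,
    Real.mul_rpow (by positivity) hTt, show (4 : ℝ) * (ν * (T - t)) = 4 * ν * (T - t) by ring]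

/-- **The backward heat kernel is two-sided Gaussian-comparable** on `(−∞, T)` about its pole,
with `c₁ = C₁ = (4πν)^{-n/2}` and `c₂ = C₂ = 4ν` (both bounds are equalities). [folklore] -/
theorem isGaussianComparable_backwardHeatKernel (hν : 0 < ν) (T : ℝ) (x₀ : E) :
    IsGaussianComparable (backwardHeatKernel ν T x₀) (Iio T) T x₀ := by
  have hc : 0 < (4 * Real.pi * ν) ^ (-(Module.finrank ℝ E : ℝ) / 2) :=
    Real.rpow_pos_of_pos (by positivity) _
  refine ⟨_, 4 * ν, _, 4 * ν, hc, by positivity, hc, by positivity, fun t ht x => ?_⟩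
  rw [backwardHeatKernel_eq hν.le x₀ (show t < T from ht) x]
  exact ⟨le_rfl, le_rfl⟩

end Heat

end Literature.Analysis.FluidPDE
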